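import Summits.Ventures.HodgeRepro2.T5SU11ResolventSymmetricClass
import Summits.Ventures.HodgeRepro2.T5SU11ResolventTransformIterates
import Summits.Ventures.HodgeRepro2.T5SU11ImproperL2Bound
import Summits.Ventures.HodgeRepro2.T5SU11ImproperHardyClass
import Summits.Ventures.HodgeRepro2.T5SU11ImproperL2Lipschitz
import Summits.Ventures.HodgeRepro2.T5SU11ImproperHardyStrictClass
import Summits.Ventures.HodgeRepro2.T5SU11ImproperL2Iterates
import Summits.Ventures.HodgeRepro2.T5SU11ImproperL2Positivity
import Summits.Ventures.HodgeRepro2.T5SU11ImproperH1Bound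
import Summits.Ventures.HodgeRepro2.T5SU11ImproperL2Neumann
import Summits.Ventures.HodgeRepro2.T5SU11ResolventStrictPositivity

/-!
# Summary XIV — the resolvent of the radial Laplacian on the exponentially decaying class: symmetry, energy,
Hardy, the spectral gap and its strictness, the `L²` bounds (rows 523–541), under uniform names

* `resolvent_symm` — `⟨G^I_λ g, h⟩ = ⟨g, G^I_λ h⟩` for two sources of rates `> 1` (row 523);
* `transform_iterate`, `transform_comp` — `((G^I_{λ₂})^n g)^(λ′) = ĝ(λ′)/(μ′ − μ₂)^n` and the composition's multiplier
  (row 524);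
* `energy_identity` — **`‖u′‖² + μ ‖u‖² = −⟨g, u⟩` for `u = G^I_λ g`, every `λ > 1`, source rate `ε > 1`** (row 531);
* `hardy_inequality` — **`‖G^I_λ g‖² ≤ ‖(G^I_λ g)′‖²`** on the class (row 532);
* `spectral_gap`, `resolvent_nonpos_all` — **`⟨g, G^I_λ g⟩ ≤ −(λ − 1)² ‖G^I_λ g‖² ≤ 0` for every `λ > 1`** (row 532);
* `l2_bound`, `l2_bound_all` — `‖G^I_λ g‖² ≤ ‖g‖²/μ²` for `λ > 2` (row 528) and **`‖G^I_λ g‖² ≤ ‖g‖²/(λ − 1)⁴` for every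
  `λ > 1`** (row 532, row 478's sharp constant on the class);
* `l2_lipschitz`, `l2_continuous` — `‖G^I_λ g − G^I_{λ₂} g‖² ≤ (μ − μ₂)² ‖g‖²/((λ − 1)⁴ (λ₂ − 1)⁴)` and `λ ↦ G^I_λ g` is
  continuous into `L²` (row 534);
* `hardy_identity` — **`‖u′‖² − ‖u‖² = ∫ sinh 2t (u′Ξ − uΞ′)²/Ξ²` on the class** (row 535);
* `hardy_inequality_strict`, `spectral_gap_strict` — **`‖G^I_λ g‖² < ‖(G^I_λ g)′‖²` and `⟨g, G^I_λ g⟩ < −(λ − 1)² ‖G^I_λ g‖²`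
  for every source `g ≢ 0`** (row 536);
* `l2_iterates` — `‖(G^I_λ)ⁿ g‖² ≤ ‖g‖²/((λ − 1)⁴)ⁿ` (row 537);
* `l2_positive`, `rayleigh_gt_one` — `‖G^I_λ g‖² > 0` and `‖(G^I_λ g)′‖²/‖G^I_λ g‖² > 1` for every source `g ≢ 0` (row 538);
* `h1_bound`, `quadratic_form_bound` — `‖(G^I_λ g)′‖² ≤ ‖g‖²/(λ − 1)² + max(0, −μ) ‖g‖²/(λ − 1)⁴` and `|⟨g, G^I_λ g⟩| ≤ ‖g‖²/(λ − 1)²`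
  (row 539);
* `neumann_l2` — **the Neumann series `Σ (μ − μ₂)^k (G^I_{λ₂})^{k+1} g` converges to `G^I_λ g` in `L²` for
  `|μ − μ₂| < (λ₂ − 1)²`** (row 540);
* `resolvent_neg` — **`G^I_λ g(t) < 0` for every `t > 0` when `g ≥ 0`, `g(t₀) > 0`** — the strong maximum principle (row 541).

Nothing is claimed about (N).

Blind lane: Mathlib + the HodgeRepro2 prefix only; no sorry; axioms ⊆ {propext, Classical.choice,
Quot.sound}.
-/

namespace Summit.Ventures.HodgeRepro2.T5SU11RadialSummaryXIV

open Filter Topology MeasureTheory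
open Set (Ioi Ioc)
open T5SU11Cartan T5SU11SphericalFunction T5SU11SphericalDecay T5SU11RadialGreenImproper
  T5SU11ResolventSymmetricClass T5SU11ResolventTransformIterates T5SU11ImproperL2Bound
  T5SU11ImproperEnergyIdentityAll T5SU11ImproperHardyClass T5SU11ImproperL2Lipschitz
  T5SU11ImproperHardyRemainderClass T5SU11ImproperHardyStrictClass T5SU11ImproperL2Iterates
  T5SU11ImproperL2Positivity T5SU11ImproperH1Bound T5SU11ImproperL2Neumann T5SU11ResolventStrictPositivity

section measure

variable [MeasurableSpace Circle] [BorelSpace Circle]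

variable {lam : ℝ} (hlam : 1 < lam) {g : ℝ → ℝ} (hg : ContinuousOn g (Ioi 0))
  {M : ℝ} (hM : ∀ s ∈ Ioc (0 : ℝ) 1, |g s| ≤ M) (hM0 : 0 ≤ M)
  {ε C s₀ : ℝ} (hε : 2 - lam < ε) (hC : ∀ s, s₀ ≤ s → |g s| ≤ C * Real.exp (-ε * s)) (hε1 : 1 < ε)

include hlam hg hM hM0 hC hε1 in
/-- **The resolvent is symmetric on the class** (row 523). -/
theorem resolvent_symm {h : ℝ → ℝ} (hh : ContinuousOn h (Ioi 0)) {M' : ℝ} (hM' : ∀ s ∈ Ioc (0 : ℝ) 1, |h s| ≤ M')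
    (hM'0 : 0 ≤ M') {ε' C' s₀' : ℝ} (hC' : ∀ s, s₀' ≤ s → |h s| ≤ C' * Real.exp (-ε' * s)) (hε'1 : 1 < ε') :
    ∫ t in Ioi 0, greenSolI (fun t => sph lam (hyp t)) (sphDecay lam) g t * h t * Real.sinh (2 * t)
      = ∫ s in Ioi 0, g s * greenSolI (fun t => sph lam (hyp t)) (sphDecay lam) h s * Real.sinh (2 * s) :=
  inner_greenSolI_symm hlam hg hM hM0 hC hh hM' hM'0 hC' hε1 hε'1

/-- **The transform of the iterates** (row 524). -/
theorem transform_iterate {lam₂ lam' : ℝ} (hlam₂ : 1 < lam₂) (h1 : 1 < lam') (h2 : lam' < lam₂)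
    {g : ℝ → ℝ} (hg : ContinuousOn g (Ioi 0)) {M : ℝ} (hM : ∀ s ∈ Ioc (0 : ℝ) 1, |g s| ≤ M) (hM0 : 0 ≤ M)
    {ε C s₀ : ℝ} (hε : lam' < ε) (hC : ∀ s, s₀ ≤ s → |g s| ≤ C * Real.exp (-ε * s)) (n : ℕ) :
    ∫ t in Ioi 0, (greenSolI (fun t => sph lam₂ (hyp t)) (sphDecay lam₂))^[n] g t * sph lam' (hyp t)
        * Real.sinh (2 * t)
      = (∫ s in Ioi 0, g s * sph lam' (hyp s) * Real.sinh (2 * s)) / (lam' * (lam' - 2) - lam₂ * (lam₂ - 2)) ^ n :=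
  transform_iterate_eq hlam₂ h1 hg hM hM0 hε hC h2 n

include hlam hg hM hM0 hε hC hε1 in
/-- **The energy identity of the resolvent on the class, every `λ > 1`** (row 531). -/
theorem energy_identity :
    (∫ t in Ioi 0, Real.sinh (2 * t) * greenSolI' (deriv fun t => sph lam (hyp t)) (sphDecay' lam)
        (fun t => sph lam (hyp t)) (sphDecay lam) g t ^ 2)
      + lam * (lam - 2) * ∫ t in Ioi 0, Real.sinh (2 * t) * greenSolI (fun t => sph lam (hyp t)) (sphDecay lam) g t ^ 2
      = -∫ t in Ioi 0, Real.sinh (2 * t) * (g t * greenSolI (fun t => sph lam (hyp t)) (sphDecay lam) g t) :=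
  energy_identity_class hlam hg hM hM0 hε hC hε1

include hlam hg hM hM0 hε hC hε1 in
/-- **The Hardy inequality on the class** (row 532). -/
theorem hardy_inequality :
    ∫ t in Ioi 0, Real.sinh (2 * t) * greenSolI (fun t => sph lam (hyp t)) (sphDecay lam) g t ^ 2
      ≤ ∫ t in Ioi 0, Real.sinh (2 * t) * greenSolI' (deriv fun t => sph lam (hyp t)) (sphDecay' lam)
        (fun t => sph lam (hyp t)) (sphDecay lam) g t ^ 2 :=
  hardy_inequality_class hlam hg hM hM0 hε hC hε1

include hlam hg hM hM0 hε hC hε1 in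
/-- **The spectral gap of the resolvent on the class, every `λ > 1`** (row 532). -/
theorem spectral_gap :
    ∫ t in Ioi 0, Real.sinh (2 * t) * (g t * greenSolI (fun t => sph lam (hyp t)) (sphDecay lam) g t)
      ≤ -((lam - 1) ^ 2 * ∫ t in Ioi 0, Real.sinh (2 * t) * greenSolI (fun t => sph lam (hyp t)) (sphDecay lam) g t ^ 2) :=
  inner_greenSolI_le_neg hlam hg hM hM0 hε hC hε1

include hlam hg hM hM0 hε hC hε1 in
/-- **`⟨g, G^I_λ g⟩ ≤ 0` for every `λ > 1`** (row 532). -/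
theorem resolvent_nonpos_all :
    ∫ t in Ioi 0, Real.sinh (2 * t) * (g t * greenSolI (fun t => sph lam (hyp t)) (sphDecay lam) g t) ≤ 0 :=
  inner_greenSolI_nonpos_all hlam hg hM hM0 hε hC hε1

include hlam hg hM hM0 hε hC hε1 in
/-- **The `L²` bound `‖G^I_λ g‖² ≤ ‖g‖²/μ²` for `λ > 2`** (row 528). -/
theorem l2_bound (h2 : 2 < lam) :
    ∫ t in Ioi 0, Real.sinh (2 * t) * greenSolI (fun t => sph lam (hyp t)) (sphDecay lam) g t ^ 2
      ≤ (∫ t in Ioi 0, Real.sinh (2 * t) * g t ^ 2) / (lam * (lam - 2)) ^ 2 :=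
  integral_sinh_mul_greenSolI_sq_le hlam hg hM hM0 hε hC h2 hε1

include hlam hg hM hM0 hε hC hε1 in
/-- **The sharp `L²` bound `‖G^I_λ g‖² ≤ ‖g‖²/(λ − 1)⁴` for every `λ > 1`** (row 532). -/
theorem l2_bound_all :
    ∫ t in Ioi 0, Real.sinh (2 * t) * greenSolI (fun t => sph lam (hyp t)) (sphDecay lam) g t ^ 2
      ≤ (∫ t in Ioi 0, Real.sinh (2 * t) * g t ^ 2) / ((lam - 1) ^ 2) ^ 2 :=
  integral_sinh_mul_greenSolI_sq_le_all hlam hg hM hM0 hε hC hε1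

include hlam hg hM hM0 hC hε1 in
/-- **The resolvent is Lipschitz in `μ` in the `L²` norm on the class** (row 534). -/
theorem l2_lipschitz {lam₂ : ℝ} (hlam₂ : 1 < lam₂) :
    ∫ t in Ioi 0, Real.sinh (2 * t) * (greenSolI (fun t => sph lam (hyp t)) (sphDecay lam) g t
        - greenSolI (fun t => sph lam₂ (hyp t)) (sphDecay lam₂) g t) ^ 2
      ≤ (lam * (lam - 2) - lam₂ * (lam₂ - 2)) ^ 2 * (∫ t in Ioi 0, Real.sinh (2 * t) * g t ^ 2)
          / (((lam - 1) ^ 2) ^ 2 * ((lam₂ - 1) ^ 2) ^ 2) :=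
  integral_sinh_mul_sub_sq_le hlam hlam₂ hg hM hM0 hC hε1

include hlam hg hM hM0 hε hC hε1 in
/-- **The Hardy identity with remainder on the class** (row 535). -/
theorem hardy_identity :
    ∫ t in Ioi 0, Real.sinh (2 * t) * (greenSolI' (deriv fun t => sph lam (hyp t)) (sphDecay' lam)
        (fun t => sph lam (hyp t)) (sphDecay lam) g t * sph 1 (hyp t)
      - greenSolI (fun t => sph lam (hyp t)) (sphDecay lam) g t * deriv (fun t => sph 1 (hyp t)) t) ^ 2
        / sph 1 (hyp t) ^ 2
      = (∫ t in Ioi 0, Real.sinh (2 * t) * greenSolI' (deriv fun t => sph lam (hyp t)) (sphDecay' lam)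
          (fun t => sph lam (hyp t)) (sphDecay lam) g t ^ 2)
        - ∫ t in Ioi 0, Real.sinh (2 * t) * greenSolI (fun t => sph lam (hyp t)) (sphDecay lam) g t ^ 2 :=
  hardy_identity_class hlam hg hM hM0 hε hC hε1

include hlam hg hM hM0 hε hC hε1 in
/-- **The strict Hardy inequality on the class for every source `g ≢ 0`** (row 536). -/
theorem hardy_inequality_strict (hne : ∃ t, 0 < t ∧ g t ≠ 0) :
    ∫ t in Ioi 0, Real.sinh (2 * t) * greenSolI (fun t => sph lam (hyp t)) (sphDecay lam) g t ^ 2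
      < ∫ t in Ioi 0, Real.sinh (2 * t) * greenSolI' (deriv fun t => sph lam (hyp t)) (sphDecay' lam)
        (fun t => sph lam (hyp t)) (sphDecay lam) g t ^ 2 :=
  hardy_inequality_strict_class hlam hg hM hM0 hε hC hε1 hne

include hlam hg hM hM0 hε hC hε1 in
/-- **The strict spectral gap `⟨g, G^I_λ g⟩ < −(λ − 1)² ‖G^I_λ g‖²` for every source `g ≢ 0`** (row 536). -/
theorem spectral_gap_strict (hne : ∃ t, 0 < t ∧ g t ≠ 0) :
    ∫ t in Ioi 0, Real.sinh (2 * t) * (g t * greenSolI (fun t => sph lam (hyp t)) (sphDecay lam) g t)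
      < -((lam - 1) ^ 2 * ∫ t in Ioi 0, Real.sinh (2 * t) * greenSolI (fun t => sph lam (hyp t)) (sphDecay lam) g t ^ 2) :=
  inner_greenSolI_lt_neg hlam hg hM hM0 hε hC hε1 hne

include hlam hg hM hM0 hC hε1 in
/-- **The sharp `L²` bound of the iterates `‖(G^I_λ)ⁿ g‖² ≤ ‖g‖²/((λ − 1)⁴)ⁿ`** (row 537). -/
theorem l2_iterates (n : ℕ) :
    ∫ t in Ioi 0, Real.sinh (2 * t) * ((greenSolI (fun t => sph lam (hyp t)) (sphDecay lam))^[n] g) t ^ 2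
      ≤ (∫ t in Ioi 0, Real.sinh (2 * t) * g t ^ 2) / (((lam - 1) ^ 2) ^ 2) ^ n :=
  integral_sinh_mul_iterate_sq_le hlam hg hM hM0 hC hε1 n

include hlam hg hM hM0 hε hC hε1 in
/-- **`‖G^I_λ g‖² > 0` for every source `g ≢ 0`** (row 538). -/
theorem l2_positive (hne : ∃ t, 0 < t ∧ g t ≠ 0) :
    0 < ∫ t in Ioi 0, Real.sinh (2 * t) * greenSolI (fun t => sph lam (hyp t)) (sphDecay lam) g t ^ 2 :=
  integral_sinh_mul_greenSolI_sq_pos hlam hg hM hM0 hε hC hε1 hne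

include hlam hg hM hM0 hε hC hε1 in
/-- **The Rayleigh quotient of `G^I_λ g` exceeds `1` for every source `g ≢ 0`** (row 538). -/
theorem rayleigh_gt_one (hne : ∃ t, 0 < t ∧ g t ≠ 0) :
    1 < (∫ t in Ioi 0, Real.sinh (2 * t) * greenSolI' (deriv fun t => sph lam (hyp t)) (sphDecay' lam)
          (fun t => sph lam (hyp t)) (sphDecay lam) g t ^ 2)
        / ∫ t in Ioi 0, Real.sinh (2 * t) * greenSolI (fun t => sph lam (hyp t)) (sphDecay lam) g t ^ 2 :=
  rayleigh_gt_one_class hlam hg hM hM0 hε hC hε1 hne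

include hlam hg hM hM0 hε hC hε1 in
/-- **The `H¹` bound of the resolvent on the class** (row 539). -/
theorem h1_bound :
    ∫ t in Ioi 0, Real.sinh (2 * t) * greenSolI' (deriv fun t => sph lam (hyp t)) (sphDecay' lam)
        (fun t => sph lam (hyp t)) (sphDecay lam) g t ^ 2
      ≤ (∫ t in Ioi 0, Real.sinh (2 * t) * g t ^ 2) / (lam - 1) ^ 2
        + max 0 (-(lam * (lam - 2))) * ((∫ t in Ioi 0, Real.sinh (2 * t) * g t ^ 2) / ((lam - 1) ^ 2) ^ 2) :=
  integral_sinh_mul_greenSolI'_sq_le hlam hg hM hM0 hε hC hε1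

include hlam hg hM hM0 hε hC hε1 in
/-- **`|⟨g, G^I_λ g⟩| ≤ ‖g‖²/(λ − 1)²`** (row 539). -/
theorem quadratic_form_bound :
    |∫ t in Ioi 0, Real.sinh (2 * t) * (g t * greenSolI (fun t => sph lam (hyp t)) (sphDecay lam) g t)|
      ≤ (∫ t in Ioi 0, Real.sinh (2 * t) * g t ^ 2) / (lam - 1) ^ 2 :=
  abs_inner_greenSolI_le' hlam hg hM hM0 hε hC hε1

include hlam hg hM hM0 hC hε1 in
/-- **The Neumann series converges in `L²` on the class for `|μ − μ₂| < (λ₂ − 1)²`** (row 540). -/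
theorem neumann_l2 {lam₂ : ℝ} (hlam₂ : 1 < lam₂) (hq : |lam * (lam - 2) - lam₂ * (lam₂ - 2)| < (lam₂ - 1) ^ 2) :
    Tendsto (fun n : ℕ => ∫ t in Ioi 0, Real.sinh (2 * t) * (greenSolI (fun t => sph lam (hyp t)) (sphDecay lam) g t
        - ∑ k ∈ Finset.range (n + 1), (lam * (lam - 2) - lam₂ * (lam₂ - 2)) ^ k
          * (greenSolI (fun t => sph lam₂ (hyp t)) (sphDecay lam₂))^[k + 1] g t) ^ 2) atTop (𝓝 0) :=
  tendsto_neumann_l2 hlam hlam₂ hg hM hM0 hC hε1 hq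

include hlam hg hM hM0 hC hε1 in
/-- **`λ′ ↦ G^I_{λ′} g` is continuous into `L²(sinh 2t dt)` at `λ`** (row 534). -/
theorem l2_continuous :
    Tendsto (fun lam' => ∫ t in Ioi 0, Real.sinh (2 * t) * (greenSolI (fun t => sph lam' (hyp t)) (sphDecay lam') g t
        - greenSolI (fun t => sph lam (hyp t)) (sphDecay lam) g t) ^ 2) (𝓝[Ioi 1] lam) (𝓝 0) :=
  tendsto_integral_sinh_mul_sub_sq hlam hg hM hM0 hC hε1

include hlam hg hM hM0 hε hC in
/-- **The strict positivity of the resolvent: `G^I_λ g(t) < 0` for every `t > 0` when `g ≥ 0` and `g(t₀) > 0`** (row 541). -/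
theorem resolvent_neg (hg0 : ∀ s, 0 < s → 0 ≤ g s) {t₀ : ℝ} (ht₀ : 0 < t₀) (hgt₀ : 0 < g t₀) {t : ℝ} (ht : 0 < t) :
    greenSolI (fun t => sph lam (hyp t)) (sphDecay lam) g t < 0 :=
  greenSolI_neg hlam hg hM hM0 hε hC hg0 ht₀ hgt₀ ht

end measure

end Summit.Ventures.HodgeRepro2.T5SU11RadialSummaryXIV
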